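import Summits.ABC.ABC.Theorems.PrimePowerRadical.Negative.WieferichValuations

/-!
# `PrimePowerRadical` (stmt-ABC-1648) implies conjecture (E_q): a second open consequence

Negative-side analysis (cdisprove seat, cycle 2). A POWERFUL member `q^k − 1` (every prime factor repeated) has
`rad(q^k − 1)² ≤ q^k − 1`, so the triple `(1, q^k − 1, q^k)` has quality `≥ 2k/(k+2)`
(`rad_family_sq_lt_of_powerful`). Hence the crux at `q`, already at `ε = 1/2`, leaves only finitely many powerful
`q^k − 1` (`finite_powerful_of_PPRAt_half`, `primePowerRadical_imp_finite_powerful`). That conclusion is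
conjecture (E_a) of Ribenboim, *The Book of Prime Number Records* (1989), Ch. 5 §III (PDF p. 201: "(E_a) There
exist at most finitely many integers `k ≥ 1` such that `a^k − 1` is powerful"), OPEN for every `a ≥ 2`; for
`a = 2` even "(M') infinitely many Mersenne numbers are not powerful" is derived there only from the finiteness
of the Wieferich primes (PDF pp. 202–204). So any proof of the crux proves (E_q) on the way.
-/

noncomputable section

namespace Summit.ABC.ABC.Theorems.PrimePowerRadical.Negative

open Literature.NumberTheory.DiophantineGeometry UniqueFactorizationMonoid
open Summit.ABC.ABC.Theses.IneffectiveSubspace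

/-- A powerful number is divisible by the square of its radical. [folklore] -/
theorem radical_sq_dvd_of_powerful {n : ℕ} (hn : n ≠ 0) (h : ∀ p ∈ n.primeFactors, p ^ 2 ∣ n) :
    radical n ^ 2 ∣ n := by
  have hR : radical n ^ 2 ≠ 0 := pow_ne_zero _ radical_ne_zero
  rw [← Nat.factorization_le_iff_dvd hR hn, Finsupp.le_def]
  intro p
  rw [Nat.factorization_pow, Finsupp.smul_apply, factorization_radical, smul_eq_mul]
  by_cases hp : p ∈ n.primeFactors
  · rw [if_pos hp, mul_one]
    exact ((Nat.prime_of_mem_primeFactors hp).pow_dvd_iff_le_factorization hn).mp (h p hp)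
  · rw [if_neg hp]; simp

/-- If `q^k − 1` is powerful then the radical of the triple is tiny: `rad(1·(q^k−1)·q^k)² < q^{k+2}`. [folklore] -/
theorem rad_family_sq_lt_of_powerful {q k : ℕ} (hq : q.Prime) (hk : 1 ≤ k)
    (h : ∀ p ∈ (q ^ k - 1).primeFactors, p ^ 2 ∣ q ^ k - 1) :
    rad 1 (q ^ k - 1) (q ^ k) ^ 2 < q ^ (k + 2) := by
  have h2 := two_le_pow hq.two_le hk
  have hn : q ^ k - 1 ≠ 0 := by omega
  have h1 : radical (q ^ k - 1) ^ 2 ≤ q ^ k - 1 :=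
    Nat.le_of_dvd (by omega) (radical_sq_dvd_of_powerful hn h)
  rw [rad_family_eq hq hk, mul_pow]
  calc radical (q ^ k - 1) ^ 2 * q ^ 2 ≤ (q ^ k - 1) * q ^ 2 := Nat.mul_le_mul_right _ h1
    _ < q ^ k * q ^ 2 :=
        Nat.mul_lt_mul_of_pos_right (Nat.sub_lt (pow_pos hq.pos k) one_pos) (pow_pos hq.pos 2)
    _ = q ^ (k + 2) := by rw [pow_add]

/-- **The crux at `q` (already at `ε = 1/2`) implies conjecture (E_q): `q^k − 1` is powerful for only
finitely many `k`.** (Ribenboim, *The Book of Prime Number Records* (1989), Ch. 5 §III: conjecture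
(E_a), OPEN for every `a ≥ 2`; it implies (W_a) = infinitely many non-Wieferich primes via Granville 1986.)
A powerful member has quality `≥ 2k/(k+2) → 2`. [folklore] -/
theorem finite_powerful_of_PPRAt_half {q : ℕ} (hq : q.Prime)
    (h : ∃ C : ℝ, 0 < C ∧ ∀ k : ℕ, 1 ≤ k →
      ((q ^ k : ℕ) : ℝ) < C * ((rad 1 (q ^ k - 1) (q ^ k) : ℕ) : ℝ) ^ (1 + (1 / 2 : ℝ))) :
    {k : ℕ | 1 ≤ k ∧ ∀ p ∈ (q ^ k - 1).primeFactors, p ^ 2 ∣ q ^ k - 1}.Finite := by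
  obtain ⟨C, hC, hCk⟩ := h
  have hq0 : (0 : ℝ) < q := by exact_mod_cast hq.pos
  have hq1 : (1 : ℝ) < q := by exact_mod_cast hq.one_lt
  have hlogq : 0 < Real.log q := Real.log_pos hq1
  -- every powerful member satisfies (k/4) log q < log C + (3/2) log q
  have key : ∀ k : ℕ, (1 ≤ k ∧ ∀ p ∈ (q ^ k - 1).primeFactors, p ^ 2 ∣ q ^ k - 1) →
      (k : ℝ) * (Real.log q / 4) < Real.log C + 3 / 2 * Real.log q := by
    rintro k ⟨hk, hpow⟩
    have h1 := hCk k hk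
    set R : ℝ := ((rad 1 (q ^ k - 1) (q ^ k) : ℕ) : ℝ) with hRdef
    have hR0 : 0 ≤ R := Nat.cast_nonneg _
    have hR2 : R ^ 2 < (q : ℝ) ^ (k + 2) := by
      have := rad_family_sq_lt_of_powerful hq hk hpow
      have h' : ((rad 1 (q ^ k - 1) (q ^ k) ^ 2 : ℕ) : ℝ) < ((q ^ (k + 2) : ℕ) : ℝ) := by
        exact_mod_cast this
      push_cast at h'
      exact h'
    -- R < q^((k+2)/2)
    have hRlt : R < (q : ℝ) ^ (((k : ℝ) + 2) / 2) := by
      have hsq : ((q : ℝ) ^ (((k : ℝ) + 2) / 2)) ^ 2 = (q : ℝ) ^ (k + 2) := by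
        rw [← Real.rpow_natCast ((q : ℝ) ^ (((k : ℝ) + 2) / 2)) 2, ← Real.rpow_mul hq0.le]
        rw [← Real.rpow_natCast]
        push_cast
        ring_nf
      refine lt_of_pow_lt_pow_left₀ 2 (Real.rpow_nonneg hq0.le _) ?_
      rw [hsq]; exact hR2
    -- R^(3/2) < q^(3(k+2)/4)
    have ht : (1 : ℝ) + 1 / 2 = 3 / 2 := by norm_num
    have hRt : R ^ ((1 : ℝ) + 1 / 2) < (q : ℝ) ^ (3 * ((k : ℝ) + 2) / 4) := by
      rw [ht]
      calc R ^ ((3 : ℝ) / 2) < ((q : ℝ) ^ (((k : ℝ) + 2) / 2)) ^ ((3 : ℝ) / 2) :=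
            Real.rpow_lt_rpow hR0 hRlt (by norm_num)
        _ = (q : ℝ) ^ (3 * ((k : ℝ) + 2) / 4) := by
            rw [← Real.rpow_mul hq0.le]; ring_nf
    have hqk : ((q ^ k : ℕ) : ℝ) = (q : ℝ) ^ (k : ℝ) := by
      rw [Nat.cast_pow, Real.rpow_natCast]
    have hmain : (q : ℝ) ^ (k : ℝ) < C * (q : ℝ) ^ (3 * ((k : ℝ) + 2) / 4) := by
      calc (q : ℝ) ^ (k : ℝ) = ((q ^ k : ℕ) : ℝ) := hqk.symm
        _ < C * R ^ ((1 : ℝ) + 1 / 2) := h1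
        _ ≤ C * (q : ℝ) ^ (3 * ((k : ℝ) + 2) / 4) := mul_le_mul_of_nonneg_left hRt.le hC.le
    have hpos : (0 : ℝ) < (q : ℝ) ^ (3 * ((k : ℝ) + 2) / 4) := Real.rpow_pos_of_pos hq0 _
    have hdiv : (q : ℝ) ^ ((k : ℝ) - 3 * ((k : ℝ) + 2) / 4) < C := by
      rw [Real.rpow_sub hq0, div_lt_iff₀ hpos]
      exact hmain
    have hlog := Real.log_lt_log (Real.rpow_pos_of_pos hq0 _) hdiv
    rw [Real.log_rpow hq0] at hlog
    have e : ((k : ℝ) - 3 * ((k : ℝ) + 2) / 4) * Real.log q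
        = (k : ℝ) * (Real.log q / 4) - 3 / 2 * Real.log q := by ring
    linarith
  obtain ⟨K, hK⟩ := exists_nat_gt ((Real.log C + 3 / 2 * Real.log q) / (Real.log q / 4))
  refine (Set.finite_Iio K).subset ?_
  intro k hk
  have h := key k hk
  rw [div_lt_iff₀ (by positivity)] at hK
  by_contra hge
  simp only [Set.mem_Iio, not_lt] at hge
  have hge' : (K : ℝ) ≤ k := by exact_mod_cast hge
  have : (K : ℝ) * (Real.log q / 4) ≤ (k : ℝ) * (Real.log q / 4) :=
    mul_le_mul_of_nonneg_right hge' (by positivity)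
  linarith

/-- **`PrimePowerRadical ⟹ (E_q) for every prime `q`**: only finitely many `q^k − 1` are powerful.
The conclusion is an open conjecture for every single base (Ribenboim 1989, Ch. 5 §III (E_a); for `q = 2`
even "infinitely many Mersenne numbers `2^ℓ − 1` are not powerful" — statement (M') there — is open). [folklore] -/
theorem primePowerRadical_imp_finite_powerful (h : PrimePowerRadical) (q : ℕ) (hq : q.Prime) :
    {k : ℕ | 1 ≤ k ∧ ∀ p ∈ (q ^ k - 1).primeFactors, p ^ 2 ∣ q ^ k - 1}.Finite :=
  finite_powerful_of_PPRAt_half hq (h q hq (1 / 2) (by norm_num))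


end Summit.ABC.ABC.Theorems.PrimePowerRadical.Negative

end
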